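import Summits.CriticalPhenomena.PercolationContinuityZ3.Theorems.PercNearOneGluingNoHeavyLowerTailSahiCoSunflowerUnionOr
import Summits.CriticalPhenomena.PercolationContinuityZ3.Theorems.PercNearOneGluingNoHeavyLowerTailSahiStrongCubicMax
import Summits.CriticalPhenomena.PercolationContinuityZ3.Theorems.PercNearOneGluingNoHeavyLowerTailSahiStrongCubicMaxAtomCovering
import Mathlib.Tactic.Linarith
import Mathlib.Tactic.Ring
import Mathlib.Tactic.Positivity
import HarnessLib

/-!
# `NoHeavyLowerTail` (crux stmt-CriticalPhenomena-4575), master-family line P1 (gen 16):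
# THEOREM — the one-payer conjecture S₃^max (`strongCubicMax ≥ 0`) on the "UNION = OR-EVENT" stratum of co-sunflowers

Support file (seat `prim-masterthm-p1`, gen 16; `--supports stmt-CriticalPhenomena-4575`).  Pure proof file, no `sorry`, standard
axioms.  Memo `run/shared/lean/prim/prim-masterthm/FROM-prim-masterthm-p1-g16-ONE-PAYER.md` §6(3).

This is the typed conjecture `SahiDeepCore.StrongCubicMaxNonneg` (tree `…SahiStrongCubicMax`: `max(κ,o)·(κo − e₂) ≥ e₃`, "the heavier of
core and outside pays for all rainbows") PROVED on gen 13's union-OR stratum (tree `…SahiCoSunflowerUnionOr`): increasing `G₁,G₂,G₃`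
such that every configuration of `G₁ ∪ G₂ ∪ G₃` contains an atom `{u} ∈ G₁ ∪ G₂ ∪ G₃` (free coordinates allowed).  It contains the
atom-covering stratum of the sibling file `…SahiStrongCubicMaxAtomCovering` (whose transfer lemma `maxCells_antitone` is reused) and
is stated directly for `strongCubicMax`.  Proof: gen 13's envelope (outside `= avoid R` of mass `Q₀Q₁Q₂`, petal `i ⊆ avoid(other
groups) ∖ avoid R`) + the max-side transfer principle + "the outside pays EXACTLY at the envelope" (`e₃ = o·G`, a `ring` identity for
the OR-block composite of the standard system), value `(max(κ,o) − o)·G ≥ 0`.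
* `strongCubicMax_nonneg_of_unionOr` — S₃^max on the stratum; corollaries `strongCubicPlus_nonneg_of_unionOr` (S₃⁺) and
  `strongCubic_nonneg_of_unionOr` (S₃; gen 13 had the class law only).
-/

noncomputable section

open scoped Classical

namespace Summit.CriticalPhenomena.PercolationContinuityZ3.Theorems

namespace SahiDeepCore

open Finset
open Literature.Combinatorics.Sahi2008
open Literature.Probability.Percolation.DecisionTree (ind ind_of_mem ind_of_not_mem ind_nonneg)

variable {ι : Type} [Fintype ι]

local notation3 (prettyPrint := false) "m⟦" p ", " X "⟧" => ex (bernoulliWeight p) (ind X)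

/-- `0 ≤ μ_p(X)`. [folklore] -/
private theorem massUO_nonneg (p : ι → unitInterval) (X : Set (Set ι)) : 0 ≤ m⟦p, X⟧ :=
  ex_nonneg (isFKGMeasure_bernoulliWeight p).nonneg fun ω => ind_nonneg _ ω

/-- `μ_p(Y ∖ X) = μ_p(Y) − μ_p(X)` for `X ⊆ Y`. [folklore] -/
private theorem massUO_sdiff (p : ι → unitInterval) {X Y : Set (Set ι)} (h : X ⊆ Y) :
    m⟦p, Y \ X⟧ = m⟦p, Y⟧ - m⟦p, X⟧ := by
  have e : ind Y = ind X + ind (Y \ X) := by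
    funext ω
    simp only [Pi.add_apply]
    by_cases hx : ω ∈ X
    · rw [ind_of_mem (h hx), ind_of_mem hx, ind_of_not_mem (fun hh : ω ∈ Y \ X => hh.2 hx), add_zero]
    · by_cases hy : ω ∈ Y
      · rw [ind_of_mem hy, ind_of_not_mem hx, ind_of_mem (show ω ∈ Y \ X from ⟨hy, hx⟩), zero_add]
      · rw [ind_of_not_mem hy, ind_of_not_mem hx, ind_of_not_mem (fun hh : ω ∈ Y \ X => hy hh.1), add_zero]
  have := congrArg (ex (bernoulliWeight p)) e
  rw [ex_add] at this
  linarith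

/-- Monotonicity of `μ_p`. [folklore] -/
private theorem massUO_mono (p : ι → unitInterval) {X Y : Set (Set ι)} (h : X ⊆ Y) : m⟦p, X⟧ ≤ m⟦p, Y⟧ := by
  have := massUO_sdiff p h
  have h0 := massUO_nonneg p (Y \ X)
  linarith

/-- **THEOREM (S₃^max when the union of the generators is an OR-event).**  If `G₁,G₂,G₃` are increasing events of the finite cube
with a product weight and every configuration of `G₁ ∪ G₂ ∪ G₃` contains an atom `{u} ∈ G₁ ∪ G₂ ∪ G₃`, then
`0 ≤ strongCubicMax p (G₂∪G₃) (G₁∪G₃) (G₁∪G₂)`, i.e. `max(κ,o)·(κo − e₂) ≥ e₃` for the co-sunflower: the one-payer conjecture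
`StrongCubicMaxNonneg` holds on this stratum. [this work] -/
theorem strongCubicMax_nonneg_of_unionOr (p : ι → unitInterval) {G₁ G₂ G₃ : Set (Set ι)} (h₁ : IsUpperSet G₁) (h₂ : IsUpperSet G₂)
    (h₃ : IsUpperSet G₃) (hgen : ∀ S : Set ι, S ∈ G₁ ∪ G₂ ∪ G₃ → ∃ u ∈ S, ({u} : Set ι) ∈ G₁ ∪ G₂ ∪ G₃) :
    0 ≤ strongCubicMax p (G₂ ∪ G₃) (G₁ ∪ G₃) (G₁ ∪ G₂) := by
  obtain ⟨s1, s2, s3⟩ := coSunflower_sandwich G₁ G₂ G₃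
  obtain ⟨e3, e2, e1⟩ := coSunflower_privateParts G₁ G₂ G₃
  obtain ⟨d01, d02, d12⟩ := grp_disjoint G₁ G₂ G₃
  have hm := mem_grp G₁ G₂ G₃
  set A := G₂ ∪ G₃ with hAdef
  set B := G₁ ∪ G₃ with hBdef
  set N := G₁ ∪ G₂ with hNdef
  set P0 := grpA G₁
  set P1 := grpB G₁ G₂
  set P2 := grpC G₁ G₂ G₃
  set R := P0 ∪ P1 ∪ P2 with hRdef
  set Q0 := ∏ u ∈ P0, (1 - (p u : ℝ))
  set Q1 := ∏ u ∈ P1, (1 - (p u : ℝ))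
  set Q2 := ∏ u ∈ P2, (1 - (p u : ℝ))
  -- outside = avoid R
  have hout : (A ∪ B)ᶜ = avoid R := by
    ext S
    simp only [hAdef, hBdef, Set.mem_compl_iff, mem_avoid]
    constructor
    · intro hS u hu huS
      have hat : ({u} : Set ι) ∈ G₁ ∪ G₂ ∪ G₃ := (mem_grp_union_iff G₁ G₂ G₃ u).1 hu
      have hsub : ({u} : Set ι) ≤ S := Set.singleton_subset_iff.2 huS
      apply hS
      rcases hat with (h | h) | h
      · exact Or.inr (Or.inl (h₁ hsub h))
      · exact Or.inl (Or.inl (h₂ hsub h))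
      · exact Or.inl (Or.inr (h₃ hsub h))
    · intro hS hU
      have hU' : S ∈ G₁ ∪ G₂ ∪ G₃ := by
        rcases hU with (h | h) | (h | h)
        · exact Or.inl (Or.inr h)
        · exact Or.inr h
        · exact Or.inl (Or.inl h)
        · exact Or.inr h
      obtain ⟨u, huS, hat⟩ := hgen S hU'
      exact hS u ((mem_grp_union_iff G₁ G₂ G₃ u).2 hat) huS
  have hprodR : ∏ u ∈ R, (1 - (p u : ℝ)) = Q0 * Q1 * Q2 := by
    rw [hRdef, Finset.prod_union (Finset.disjoint_union_left.2 ⟨d02, d12⟩), Finset.prod_union d01]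
  have ho : m⟦p, (A ∪ B)ᶜ⟧ = Q0 * Q1 * Q2 := by rw [hout, m_avoid, hprodR]
  have notout : ∀ S : Set ι, S ∈ G₁ ∪ G₂ ∪ G₃ → S ∉ avoid R := by
    intro S hS hav
    have : S ∈ (A ∪ B)ᶜ := by rw [hout]; exact hav
    apply this
    rcases hS with (h | h) | h
    · exact Or.inr (Or.inl h)
    · exact Or.inl (Or.inl h)
    · exact Or.inl (Or.inr h)
  have pet1 : A \ B ⊆ avoid (P0 ∪ P2) \ avoid R := by
    rw [hAdef, hBdef, e2]
    intro S hS
    have hS2 : S ∈ G₂ := hS.1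
    have hS1 : S ∉ G₁ := fun h => hS.2 (Or.inl h)
    have hS3 : S ∉ G₃ := fun h => hS.2 (Or.inr h)
    refine ⟨?_, notout S (Or.inl (Or.inr hS2))⟩
    intro u hu huS
    have hsub : ({u} : Set ι) ≤ S := Set.singleton_subset_iff.2 huS
    rcases Finset.mem_union.1 hu with h | h
    · exact hS1 (h₁ hsub ((hm u).1.1 h))
    · exact hS3 (h₃ hsub ((hm u).2.2.1 h).1)
  have pet2 : B \ A ⊆ avoid (P1 ∪ P2) \ avoid R := by
    rw [hAdef, hBdef, e1]
    intro S hS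
    have hS1 : S ∈ G₁ := hS.1
    have hS2 : S ∉ G₂ := fun h => hS.2 (Or.inl h)
    have hS3 : S ∉ G₃ := fun h => hS.2 (Or.inr h)
    refine ⟨?_, notout S (Or.inl (Or.inl hS1))⟩
    intro u hu huS
    have hsub : ({u} : Set ι) ≤ S := Set.singleton_subset_iff.2 huS
    rcases Finset.mem_union.1 hu with h | h
    · exact hS2 (h₂ hsub ((hm u).2.1.1 h).1)
    · exact hS3 (h₃ hsub ((hm u).2.2.1 h).1)
  have pet3 : (A ∩ B) \ N ⊆ avoid (P0 ∪ P1) \ avoid R := by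
    rw [hAdef, hBdef, hNdef, e3]
    intro S hS
    have hS3 : S ∈ G₃ := hS.1
    have hS1 : S ∉ G₁ := fun h => hS.2 (Or.inl h)
    have hS2 : S ∉ G₂ := fun h => hS.2 (Or.inr h)
    refine ⟨?_, notout S (Or.inr hS3)⟩
    intro u hu huS
    have hsub : ({u} : Set ι) ≤ S := Set.singleton_subset_iff.2 huS
    rcases Finset.mem_union.1 hu with h | h
    · exact hS1 (h₁ hsub ((hm u).1.1 h))
    · exact hS2 (h₂ hsub ((hm u).2.1.1 h).1)
  have env : ∀ X : Finset ι, X ⊆ R → m⟦p, avoid X \ avoid R⟧ = (∏ u ∈ X, (1 - (p u : ℝ))) - Q0 * Q1 * Q2 := by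
    intro X hX; rw [massUO_sdiff p (avoid_mono hX), m_avoid, m_avoid, hprodR]
  have sub02 : P0 ∪ P2 ⊆ R :=
    Finset.union_subset (Finset.subset_union_left.trans Finset.subset_union_left) Finset.subset_union_right
  have sub12 : P1 ∪ P2 ⊆ R :=
    Finset.union_subset (Finset.subset_union_right.trans Finset.subset_union_left) Finset.subset_union_right
  have sub01 : P0 ∪ P1 ⊆ R := Finset.subset_union_left
  have hα : m⟦p, A \ B⟧ ≤ Q0 * Q2 - Q0 * Q1 * Q2 := by
    refine le_trans (massUO_mono p pet1) ?_; rw [env _ sub02, Finset.prod_union d02]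
  have hβ : m⟦p, B \ A⟧ ≤ Q1 * Q2 - Q0 * Q1 * Q2 := by
    refine le_trans (massUO_mono p pet2) ?_; rw [env _ sub12, Finset.prod_union d12]
  have hd : m⟦p, (A ∩ B) \ N⟧ ≤ Q0 * Q1 - Q0 * Q1 * Q2 := by
    refine le_trans (massUO_mono p pet3) ?_; rw [env _ sub01, Finset.prod_union d01]
  -- eliminate the core mass, Gladkov at the actual point
  have hsum := cells_sum_eq_one p A B N
  have hk : m⟦p, A ∩ B ∩ N⟧ = 1 - m⟦p, (A ∪ B)ᶜ⟧ - m⟦p, A \ B⟧ - m⟦p, B \ A⟧ - m⟦p, (A ∩ B) \ N⟧ := by linarith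
  have hG0 := gladkov_cells p (h₂.union h₃) (h₁.union h₃) (h₁.union h₂) s1 s2 s3
  simp only [strongCubicMax, gladkovDefect]
  rw [hk]
  rw [hk] at hG0
  rw [ho] at hG0 ⊢
  have q0 := prod_oneSub_mem p P0
  have q1 := prod_oneSub_mem p P1
  have q2 := prod_oneSub_mem p P2
  have hQ : 0 ≤ Q0 * Q1 * Q2 := mul_nonneg (mul_nonneg q0.1 q1.1) q2.1
  have key := maxCells_antitone (o := Q0 * Q1 * Q2) hQ (massUO_nonneg p _) (massUO_nonneg p _) (massUO_nonneg p _)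
    hα hβ hd (sub_nonneg.2 hG0)
  have hGenv : (1 - Q0 * Q1 * Q2 - (Q0 * Q2 - Q0 * Q1 * Q2) - (Q1 * Q2 - Q0 * Q1 * Q2) - (Q0 * Q1 - Q0 * Q1 * Q2))
        * (Q0 * Q1 * Q2)
        - ((Q0 * Q2 - Q0 * Q1 * Q2) * (Q1 * Q2 - Q0 * Q1 * Q2) + (Q0 * Q2 - Q0 * Q1 * Q2) * (Q0 * Q1 - Q0 * Q1 * Q2)
            + (Q1 * Q2 - Q0 * Q1 * Q2) * (Q0 * Q1 - Q0 * Q1 * Q2))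
        = Q0 * Q1 * Q2 * ((1 - Q0) * (1 - Q1) * (1 - Q2)) := by ring
  have he3env : (Q0 * Q2 - Q0 * Q1 * Q2) * (Q1 * Q2 - Q0 * Q1 * Q2) * (Q0 * Q1 - Q0 * Q1 * Q2)
        = Q0 * Q1 * Q2 * (Q0 * Q1 * Q2 * ((1 - Q0) * (1 - Q1) * (1 - Q2))) := by ring
  have hGenv0 : 0 ≤ Q0 * Q1 * Q2 * ((1 - Q0) * (1 - Q1) * (1 - Q2)) :=
    mul_nonneg hQ (mul_nonneg (mul_nonneg (sub_nonneg.2 q0.2) (sub_nonneg.2 q1.2)) (sub_nonneg.2 q2.2))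
  have hval : 0 ≤ max (1 - Q0 * Q1 * Q2 - (Q0 * Q2 - Q0 * Q1 * Q2) - (Q1 * Q2 - Q0 * Q1 * Q2) - (Q0 * Q1 - Q0 * Q1 * Q2))
        (Q0 * Q1 * Q2) *
        ((1 - Q0 * Q1 * Q2 - (Q0 * Q2 - Q0 * Q1 * Q2) - (Q1 * Q2 - Q0 * Q1 * Q2) - (Q0 * Q1 - Q0 * Q1 * Q2))
          * (Q0 * Q1 * Q2)
          - ((Q0 * Q2 - Q0 * Q1 * Q2) * (Q1 * Q2 - Q0 * Q1 * Q2) + (Q0 * Q2 - Q0 * Q1 * Q2) * (Q0 * Q1 - Q0 * Q1 * Q2)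
              + (Q1 * Q2 - Q0 * Q1 * Q2) * (Q0 * Q1 - Q0 * Q1 * Q2)))
        - (Q0 * Q2 - Q0 * Q1 * Q2) * (Q1 * Q2 - Q0 * Q1 * Q2) * (Q0 * Q1 - Q0 * Q1 * Q2) := by
    rw [hGenv, he3env]
    have hmo : Q0 * Q1 * Q2 ≤ max (1 - Q0 * Q1 * Q2 - (Q0 * Q2 - Q0 * Q1 * Q2) - (Q1 * Q2 - Q0 * Q1 * Q2)
        - (Q0 * Q1 - Q0 * Q1 * Q2)) (Q0 * Q1 * Q2) := le_max_right _ _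
    nlinarith [mul_le_mul_of_nonneg_right hmo hGenv0]
  linarith

/-- **COROLLARY (S₃⁺ on the union-OR stratum).** [this work] -/
theorem strongCubicPlus_nonneg_of_unionOr (p : ι → unitInterval) {G₁ G₂ G₃ : Set (Set ι)} (h₁ : IsUpperSet G₁)
    (h₂ : IsUpperSet G₂) (h₃ : IsUpperSet G₃)
    (hgen : ∀ S : Set ι, S ∈ G₁ ∪ G₂ ∪ G₃ → ∃ u ∈ S, ({u} : Set ι) ∈ G₁ ∪ G₂ ∪ G₃) :
    0 ≤ strongCubicPlus p (G₂ ∪ G₃) (G₁ ∪ G₃) (G₁ ∪ G₂) := by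
  obtain ⟨s1, s2, s3⟩ := coSunflower_sandwich G₁ G₂ G₃
  exact le_trans (strongCubicMax_nonneg_of_unionOr p h₁ h₂ h₃ hgen)
    (strongCubicMax_le_strongCubicPlus p (h₂.union h₃) (h₁.union h₃) (h₁.union h₂) s1 s2 s3)

/-- **COROLLARY (S₃ on the union-OR stratum).** [this work] -/
theorem strongCubic_nonneg_of_unionOr (p : ι → unitInterval) {G₁ G₂ G₃ : Set (Set ι)} (h₁ : IsUpperSet G₁)
    (h₂ : IsUpperSet G₂) (h₃ : IsUpperSet G₃)
    (hgen : ∀ S : Set ι, S ∈ G₁ ∪ G₂ ∪ G₃ → ∃ u ∈ S, ({u} : Set ι) ∈ G₁ ∪ G₂ ∪ G₃) :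
    0 ≤ strongCubic p (G₂ ∪ G₃) (G₁ ∪ G₃) (G₁ ∪ G₂) := by
  obtain ⟨s1, s2, s3⟩ := coSunflower_sandwich G₁ G₂ G₃
  exact le_trans (strongCubicPlus_nonneg_of_unionOr p h₁ h₂ h₃ hgen)
    (strongCubicPlus_le_strongCubic p (h₂.union h₃) (h₁.union h₃) (h₁.union h₂) s1 s2 s3)

end SahiDeepCore

end Summit.CriticalPhenomena.PercolationContinuityZ3.Theorems
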